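import Literature.NumberTheory.NumberFields.NormRelationPushforward
import HarnessLib

/-!
# The Klein-four norm relation `2 = N_⟨u⟩ + N_⟨v⟩ − u·N_⟨uv⟩` (Biasse–Fieker–Hofmann–Page 2022, Example 2.5) as a
# kernel-checked identity in `ℤ[G]`, for ANY finite group `G` containing commuting involutions `u ≠ v`

Topic `NumberTheory/NumberFields`; companion of `ClassGroupNormRelations.lean` / `NormRelationPushforward.lean`.
THEOREM-ONLY file (no definition, no named fact, no `sorry`), written by the literature seat `bsd-potss-conjA-anchor` g11
(cell `bsd-potss`; supports stmt-BirchSwinnertonDyer-19386 / 19413; closes nothing).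

[BiasseEtAl2022] J.-F. Biasse, C. Fieker, T. Hofmann, A. Page, *Norm relations and computational problems in number fields*,
J. London Math. Soc. 105 (2022), Example 2.5 (held text `paper:arxiv-2002.12332`, p. 6): «Let `G = C₂ × C₂ = ⟨σ, τ⟩`. Then we
have the norm relation `2 = N_⟨σ⟩ + N_⟨τ⟩ − σ N_⟨στ⟩`. This is the relation used by Wada, Bauch–Bernstein–de Valence–Lange–van
Vredendaal as well as by Biasse and van Vredendaal.»  Being an identity in `ℤ[V]`, `V = {1, u, v, uv}`, it holds verbatim in
`ℤ[G]` for every group `G ⊇ V` (Def. 2.1; cf. `NormRelation.normRelation_map_of_injective`), i.e. it is a norm relation of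
`G` with respect to the three subgroups `⟨u⟩, ⟨v⟩, ⟨uv⟩` of order `2`, with denominator `d = 2` — prime to every odd `p`.

* `normRelation_klein_four` — the relation in the coefficientwise form `hrel` consumed by
  `NormRelation.padicValNat_card_classGroup_le_sum_of_normRelation` (Prop. 3.7: `v_p h(L) ≤ v_p h(L^{⟨u⟩}) + v_p h(L^{⟨v⟩}) +
  v_p h(L^{⟨uv⟩})` for `p` odd) and by `IwasawaTheory.classNumberPExp_restrict_le_sum_of_normRelation` /
  `classicalMuVanishes_of_isCyclotomic_of_normRelation` (μ-descent along the cyclotomic tower): family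
  `![zpowers u, zpowers v, zpowers (u * v)]`, `a = ![δ₁, δ₁, −δ_u]`, `b = ![δ₁, δ₁, δ₁]`, `d = 2`.

Use (cell `bsd-potss`, `p = 3` Cartan rows of the Coates–Sujatha census; a KERNEL certificate replacing the displayed
`ℤ[G]`-identities of `pub/bsd-potss/conjA-anchor/g10/cert/` for these image types).  `L = ℚ(E[3])`, `G = Gal(L/ℚ)`:
* split Cartan normaliser `N_s(3) ≅ D₄ = ⟨r, s⟩` (`r² = −1` central): `u = −1`, `v = s` a reflection fixing a point `P` of
  order `3`; supports `L^{⟨−1⟩} = ℚ(x(E[3]))` (Galois with group `D₄/±1 ≅ C₂²`, abelian — Ferrero–Washington) and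
  `L^{⟨s⟩} = ℚ(P) ≅ L^{⟨−s⟩}` (`−s = r s r⁻¹`; Iwasawa 1956 / Fukuda 1994 certificates);
* non-split Cartan normaliser `N_ns(3) ≅ SD₁₆`: every Klein four-subgroup contains `−1`; with `v = s` a non-Cartan
  involution the supports are `L^{⟨s⟩} = ℚ(P) ≅ L^{⟨−s⟩}` (degree `8`) and the `D₄`-octic `L^{⟨−1⟩} = ℚ(x(E[3]))`, to which the
  first bullet applies in turn (supports: the biquadratic field `L^{⟨r²⟩}` and the quartic `ℚ(x(P))`).
-/

noncomputable section

namespace Literature.NumberTheory.NumberFields.NormRelation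

section KleinFour

variable {G : Type*} [Group G] [Fintype G] [DecidableEq G]

omit [Fintype G] [DecidableEq G] in
/-- The cyclic subgroup generated by an involution `w` is `{1, w}`. [cite: BiasseEtAl2022, Example 2.5] -/
private theorem mem_zpowers_iff_of_mul_self_eq_one {w x : G} (hw : w * w = 1) :
    x ∈ Subgroup.zpowers w ↔ x = 1 ∨ x = w := by
  have h2 : w ^ (2 : ℤ) = 1 := by rw [zpow_two]; exact hw
  constructor
  · intro hx
    rw [Subgroup.mem_zpowers_iff] at hx
    obtain ⟨k, rfl⟩ := hx
    rcases Int.emod_two_eq_zero_or_one k with hk | hk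
    · left
      rw [← Int.mul_ediv_add_emod k 2, zpow_add, zpow_mul, h2, one_zpow, one_mul, hk, zpow_zero]
    · right
      rw [← Int.mul_ediv_add_emod k 2, zpow_add, zpow_mul, h2, one_zpow, one_mul, hk, zpow_one]
  · intro hx
    rcases hx with hx | hx
    · rw [hx]; exact one_mem _
    · rw [hx]; exact Subgroup.mem_zpowers w

omit [Fintype G] [DecidableEq G] in
/-- `∑_{h ∈ H} δ₁(h⁻¹ y) = [y ∈ H]`. [cite: BiasseEtAl2022, §2.1] -/
private theorem sum_subgroup_ite_inv_mul_eq_one [DecidableEq G] (H : Subgroup G) [Fintype H]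
    [DecidablePred (· ∈ H)] (y : G) :
    (∑ h : H, (if (h : G)⁻¹ * y = 1 then (1 : ℤ) else 0)) = if y ∈ H then 1 else 0 := by
  by_cases hy : y ∈ H
  · rw [if_pos hy, Finset.sum_eq_single (⟨y, hy⟩ : H)]
    · simp
    · intro h _ hne
      rw [if_neg]
      intro heq
      apply hne
      exact Subtype.ext (inv_mul_eq_one.mp heq)
    · intro h; exact absurd (Finset.mem_univ _) h
  · rw [if_neg hy]
    refine Finset.sum_eq_zero fun h _ => ?_
    rw [if_neg]
    intro heq
    apply hy
    rw [← inv_mul_eq_one.mp heq]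
    exact h.2

omit [DecidableEq G] in
/-- `∑_x z·δ_c(x)·∑_{h ∈ H} δ₁(h⁻¹x⁻¹g) = z·[c⁻¹ g ∈ H]` — one term `a N_H b` of a relation, with `a = z·δ_c`, `b = δ₁`.
[cite: BiasseEtAl2022, §2.1] -/
private theorem sum_ite_mul_sum_subgroup [DecidableEq G] (H : Subgroup G) [Fintype H] [DecidablePred (· ∈ H)]
    (c g : G) (z : ℤ) :
    (∑ x : G, ∑ h : H, (if x = c then z else 0) * (if (h : G)⁻¹ * x⁻¹ * g = 1 then (1 : ℤ) else 0)) =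
      if c⁻¹ * g ∈ H then z else 0 := by
  rw [Finset.sum_eq_single c]
  · have key : ∀ h : H, (if c = c then z else 0) * (if (h : G)⁻¹ * c⁻¹ * g = 1 then (1 : ℤ) else 0) =
        z * (if (h : G)⁻¹ * (c⁻¹ * g) = 1 then (1 : ℤ) else 0) := fun h => by
      rw [if_pos rfl, mul_assoc]
    rw [Finset.sum_congr rfl fun h _ => key h, ← Finset.mul_sum,
      sum_subgroup_ite_inv_mul_eq_one H (c⁻¹ * g)]
    by_cases hc : c⁻¹ * g ∈ H
    · rw [if_pos hc, if_pos hc, mul_one]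
    · rw [if_neg hc, if_neg hc, mul_zero]
  · intro x _ hx
    rw [if_neg hx]
    simp only [zero_mul, Finset.sum_const_zero]
  · intro h; exact absurd (Finset.mem_univ _) h

/-- The Klein-four relation for given subgroups `H₀ = {1,u}`, `H₁ = {1,v}`, `H₂ = {1,uv}` (any `Fintype` structures).
[cite: BiasseEtAl2022, Example 2.5] -/
private theorem klein_aux {u v : G} (hu : u * u = 1) (hu1 : u ≠ 1) (hv1 : v ≠ 1) (hne : u ≠ v)
    (H₀ H₁ H₂ : Subgroup G) [Fintype H₀] [Fintype H₁] [Fintype H₂]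
    (h₀ : ∀ x, x ∈ H₀ ↔ x = 1 ∨ x = u) (h₁ : ∀ x, x ∈ H₁ ↔ x = 1 ∨ x = v)
    (h₂ : ∀ x, x ∈ H₂ ↔ x = 1 ∨ x = u * v) (g : G) :
    (∑ x : G, ∑ h : H₀, (if x = 1 then (1 : ℤ) else 0) * (if (h : G)⁻¹ * x⁻¹ * g = 1 then (1 : ℤ) else 0)) +
    (∑ x : G, ∑ h : H₁, (if x = 1 then (1 : ℤ) else 0) * (if (h : G)⁻¹ * x⁻¹ * g = 1 then (1 : ℤ) else 0)) +
    (∑ x : G, ∑ h : H₂, (if x = u then (-1 : ℤ) else 0) * (if (h : G)⁻¹ * x⁻¹ * g = 1 then (1 : ℤ) else 0)) =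
      if g = 1 then ((2 : ℕ) : ℤ) else 0 := by
  classical
  rw [sum_ite_mul_sum_subgroup H₀, sum_ite_mul_sum_subgroup H₁, sum_ite_mul_sum_subgroup H₂, inv_one, one_mul]
  have e1 : u⁻¹ * g = 1 ↔ g = u := by rw [inv_mul_eq_one, eq_comm]
  have e2 : u⁻¹ * g = u * v ↔ g = v := by
    rw [inv_mul_eq_iff_eq_mul, ← mul_assoc, hu, one_mul]
  simp only [h₀, h₁, h₂, e1, e2]
  by_cases hg1 : g = 1
  · subst hg1
    simp [hu1.symm, hv1.symm]
  · by_cases hgu : g = u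
    · subst hgu
      simp [hg1, hne]
    · by_cases hgv : g = v
      · subst hgv
        simp [hg1, hgu]
      · simp [hg1, hgu, hgv]

/-- **The Klein-four norm relation** ([BiasseEtAl2022] Example 2.5: «`2 = N_⟨σ⟩ + N_⟨τ⟩ − σ N_⟨στ⟩`» in `ℤ[C₂ × C₂]`),
valid in `ℤ[G]` for every finite group `G` and commuting involutions `u ≠ v` of `G` (it is an identity inside
`ℤ[⟨u, v⟩] ⊆ ℤ[G]`, Def. 2.1): in the coefficientwise form `hrel` of `ClassGroupNormRelations.lean`, with the family
`H = (⟨u⟩, ⟨v⟩, ⟨uv⟩)`, `a = (δ₁, δ₁, −δ_u)`, `b = (δ₁, δ₁, δ₁)` and denominator `d = 2`,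
`∑ᵢ ∑ₓ ∑_{h ∈ Hᵢ} aᵢ(x) bᵢ(h⁻¹x⁻¹g) = 2·[g = 1]` for all `g ∈ G` (whatever `Fintype` structures the subgroups carry).  For
`p` odd this feeds `padicValNat_card_classGroup_le_sum_of_normRelation` (`v_p h(L) ≤ v_p h(L^{⟨u⟩}) + v_p h(L^{⟨v⟩}) +
v_p h(L^{⟨uv⟩})`) and the μ-descent `IwasawaTheory.classicalMuVanishes_of_isCyclotomic_of_normRelation`.
[cite: BiasseEtAl2022, Example 2.5, Def. 2.1] -/
theorem normRelation_klein_four {u v : G} (hu : u * u = 1) (hv : v * v = 1) (huv : u * v = v * u)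
    (hu1 : u ≠ 1) (hv1 : v ≠ 1) (hne : u ≠ v)
    [hF : ∀ i, Fintype ↥((![Subgroup.zpowers u, Subgroup.zpowers v, Subgroup.zpowers (u * v)] :
      Fin 3 → Subgroup G) i)]
    (g : G) :
    (∑ i : Fin 3, ∑ x : G,
      ∑ h : (![Subgroup.zpowers u, Subgroup.zpowers v, Subgroup.zpowers (u * v)] : Fin 3 → Subgroup G) i,
        (![fun x => if x = 1 then (1 : ℤ) else 0, fun x => if x = 1 then (1 : ℤ) else 0,
            fun x => if x = u then (-1 : ℤ) else 0] : Fin 3 → G → ℤ) i x *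
          (fun (_ : Fin 3) (y : G) => if y = 1 then (1 : ℤ) else 0) i
            (((h : G))⁻¹ * x⁻¹ * g)) =
      if g = 1 then ((2 : ℕ) : ℤ) else 0 := by
  have huv1 : (u * v) * (u * v) = 1 := by
    calc (u * v) * (u * v) = u * (v * u) * v := by group
      _ = u * (u * v) * v := by rw [huv]
      _ = (u * u) * (v * v) := by group
      _ = 1 := by rw [hu, hv, one_mul]
  rw [Fin.sum_univ_three]
  exact @klein_aux G _ _ _ u v hu hu1 hv1 hne (Subgroup.zpowers u) (Subgroup.zpowers v)
    (Subgroup.zpowers (u * v)) (hF 0) (hF 1) (hF 2)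
    (fun x => mem_zpowers_iff_of_mul_self_eq_one hu) (fun x => mem_zpowers_iff_of_mul_self_eq_one hv)
    (fun x => mem_zpowers_iff_of_mul_self_eq_one huv1) g

end KleinFour

end Literature.NumberTheory.NumberFields.NormRelation

end
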